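import Summits.BirchSwinnertonDyer.BirchSwinnertonDyer.Theses.GenusKolyvaginAtTwo
import Literature.NumberTheory.EllipticCurves.BSDSelmerPConverseCommonLeavesProofs
import Literature.NumberTheory.EllipticCurves.BSDHeegnerPointsModularityOnlyProofs
import HarnessLib

/-!
# SKELETON LINE `heegner_field_road_off_semistable` for item 24948 `RankOneTwoConverseOffSemistableAtTwo`
# (route GenusKolyvaginAtTwo, support r203, DECLARED RESIDUAL — the corank-1 2-CONVERSE OFF the semistable-ordinary-at-2 class:
#  good supersingular or additive reduction at 2)

line-writer skeleton (linewriter-bsd-genuskolyattwo-1 g0); NOT leaf progress. The item reads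
`∀ E/ℚ non-CM, globally minimal, ¬(good ordinary ∨ multiplicative at 2), corank_{ℤ₂} Sel_{2^∞}(E/ℚ) = 1 ⇒ ord_{s=1} L(E,s) = 1`;
the class hypothesis is split (PROVED below, reduction trichotomy) into the two cells GOOD SUPERSINGULAR at 2 / ADDITIVE at 2.
This line is the printed road of EVERY odd-p converse theorem (Skinner 2014 Thm B → W. Zhang 2014 Thm 1.3 →
Burungale–Skinner–Tian–Wan arXiv:2409.01350 Thm 1.10, proof of Thm 12.3 p. 96; tree template
`Literature.NumberTheory.EllipticCurves.analyticRank_eq_one_of_selmerCorank_eq_one_of_rootNumber_eq_neg_one`, which carries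
`p ≠ 2`) with the prime 2 PUT BACK, cut so that every printed step is a by-name stub and the single unprinted step is isolated:
1. SIGN (print, = route item `TwoParityDD` 23327 by name: Dokchitser–Dokchitser Ann. Math. 172 (2010) Thm 1.4 + Cor 4.20 at p = 2):
   corank 1 ⇒ w(E) = −1.
2. FIELD + RANK-0 TWIST (print): Friedberg–Hoffstein / Bump–Friedberg–Hoffstein give an imaginary quadratic K with the Heegner
   hypothesis for N_E, 2 SPLIT in K and L(E^{(d_K)},1) ≠ 0 (`friedbergHoffstein_exists_heegnerField_split_twist_ne_zero` at p = 2);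
   Kato + Gross–Zagier–Kolyvagin (`rank_eq_analyticRank_of_analyticRank_le_one`, theorem
   `kato_finite_of_L_one_ne_zero_of_rank_eq_analyticRank`) make Sel_{2^∞}(E^{(d_K)}/ℚ) finite, and the PROVED base-change identity
   `selmerCorank_baseChange_quadratic_holds` gives corank_{ℤ₂} Sel_{2^∞}(E/K) = 1.
3. HEEGNER POINT NON-TORSION FROM 2-SELMER CORANK ONE OVER K (research — the 2-adic hole; two cells by reduction type at 2):
   P_K ∈ E(K) (exists: `exists_isHeegnerPoint`, print) is of infinite order. For odd p this is the BDP-formula / anticyclotomic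
   main-conjecture step (Skinner Thm B; BST; BSTW §12) or the Kolyvagin-system primitivity step (W. Zhang Thm 1.3); at p = 2 no
   printed engine: BDP interpolation and the Heegner-point main conjecture are stated for p odd (Castella–Wan, Burungale–Castella–Kim
   p > 2), Zhang's indivisibility needs p ≥ 5; off the ordinary locus even the odd-p engines are special (signed/♯♭ Selmer groups:
   Castella–Wan arXiv:1506.02538, Kobayashi–Ota; additive p: Kriz's ramified BDP theory). Cell (a′) good supersingular at 2 (2 split in
   K); cell (b′) additive at 2 (4 ∣ N_E; 2 split in K by the Heegner hypothesis).
4. GROSS–ZAGIER (print, = route items `GrossZagierAllLevels` 24148 and `ModularityExistsNewform` 19382 by name, via the tree THEOREM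
   `analyticRankEK_eq_one_iff_heegner_nonTorsion_of_exists_isNewformOf`): P_K non-torsion ⇒ ord_{s=1} L(E/K,s) = 1; the factorisation
   L(E/K,s) = L(E,s)·L(E^{(d_K)},s) (`analyticRankEK_eq_add_of`, theorem from modularity) and L(E^{(d_K)},1) ≠ 0 give ord L(E,s) = 1.
Composition PROVED below (kernel-checked), concluding the route decl `Theses.GenusKolyvaginAtTwo.RankOneTwoConverseOffSemistableAtTwo`
BY NAME (same road as the sibling line `RankOneTwoConverse/Lines/heegner_field_road.lean` for item 19220; the cells differ).
Sorries ONLY inside `stub_*`; nothing asserted; BSD is proved for no curve.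
-/

set_option autoImplicit false
set_option linter.dupNamespace false

namespace Summit.BirchSwinnertonDyer.BirchSwinnertonDyer.Cruxes.RankOneTwoConverseOffSemistableAtTwo.HeegnerFieldRoadOffSemistable

open scoped Classical

open WeierstrassCurve Literature.NumberTheory.EllipticCurves
open Summit.BirchSwinnertonDyer.BirchSwinnertonDyer.Theses.GenusKolyvaginAtTwo
  (RankOneTwoConverseOffSemistableAtTwo TwoParityDD ModularityExistsNewform GrossZagierAllLevels)

/-- [print · item by name] stub SIGN — the 2-parity theorem `(-1)^{corank_{ℤ₂} Sel_{2^∞}(E/ℚ)} = w(E)` for every E/ℚ: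
route item `TwoParityDD` (stmt-BirchSwinnertonDyer-23327) VERBATIM (Dokchitser–Dokchitser 2010, Thm 1.4 with Cor 4.20).
[cite: DokchitserDokchitserAnnals2010, Thm. 1.4] -/
theorem stub_twoParityDD : TwoParityDD := by
  sorry

/-- [print · items/facts by name] stub PRINTED LEAVES — modularity (route item `ModularityExistsNewform` 19382 = BCDT 2001 Thm A),
the Gross–Zagier formula at every level (route item `GrossZagierAllLevels` 24148 = Gross–Zagier 1986 Thm I.6.3),
Gross–Zagier–Kolyvagin in analytic rank ≤ 1 (named fact `rank_eq_analyticRank_of_analyticRank_le_one`, Darmon 2004 Thm 3.22),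
the Friedberg–Hoffstein Heegner field with 2 split and a rank-0 twist (named fact
`friedbergHoffstein_exists_heegnerField_split_twist_ne_zero`, Friedberg–Hoffstein Ann. Math. 142 (1995) Thm B with
Waldspurger / BFH), and K-rationality of the Heegner point (named fact `exists_isHeegnerPoint`, Gross–Zagier 1986 I.§4).
[cite: BCDTJAMS2001, Thm. A] [cite: GrossZagier1986, Thm. I.6.3] [cite: Darmon2004, Thm. 3.22] [cite: FriedbergHoffstein1995, Thm. B] -/
theorem stub_printedLeaves :
    ModularityExistsNewform ∧ GrossZagierAllLevels ∧ rank_eq_analyticRank_of_analyticRank_le_one ∧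
      friedbergHoffstein_exists_heegnerField_split_twist_ne_zero ∧
      (∀ (W : WeierstrassCurve ℚ) (K : Type) [Field K] [NumberField K], exists_isHeegnerPoint W K) := by
  sorry

/-- [research] stub (a′) — HEEGNER POINT NON-TORSION FROM 2^∞-SELMER CORANK ONE, GOOD SUPERSINGULAR AT 2: for E/ℚ non-CM with
good supersingular reduction at 2 (2 ∣ a₂, i.e. a₂ ∈ {0, ±2}), K imaginary quadratic with the Heegner hypothesis for N_E and 2 split in
K, corank_{ℤ₂} Sel_{2^∞}(E/K) = 1 ⇒ every Heegner point P_K ∈ E(K) of level N_E has infinite order. (Odd-p print, supersingular: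
Castella–Wan arXiv:1506.02538 Thm 1.3 (p-converse at good supersingular p ≥ 5 via the ♯/♭ Heegner-point main conjecture);
Burungale–Tian Invent. Math. 2020 (CM). No p = 2 version in print.) -/
theorem stub_heegnerNonTorsion_of_selmerCorankTwo_eq_one_goodSS :
    ∀ (W : WeierstrassCurve ℚ) [W.IsElliptic] [W.IsGloballyMinimal] [NeZero (W.conductorNorm ℤ)], ¬ W.HasCM →
      Rank1Residual.GoodSS W 2 →
      ∀ (K : Type) [Field K] [NumberField K], IsImaginaryQuadratic K →
        SatisfiesHeegnerHypothesis (W.conductorNorm ℤ) K → SatisfiesHeegnerHypothesis 2 K →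
        (W.baseChange K).selmerCorank 2 = 1 →
        ∀ (P : (W.baseChange K).toAffine.Point), IsHeegnerPoint (W.conductorNorm ℤ) W K P → ¬ IsOfFinAddOrder P := by
  sorry

/-- [research] stub (b′) — HEEGNER POINT NON-TORSION FROM 2^∞-SELMER CORANK ONE, ADDITIVE AT 2: the same conclusion for E/ℚ
non-CM with additive reduction at 2 (4 ∣ N_E; 2 splits in K by the Heegner hypothesis). (Odd-p print for additive p: Kriz,
*Supersingular p-adic L-functions, Maass–Shimura operators and Waldspurger formulas*, Ann. Math. Studies 212 (2021) — BDP-type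
formula at ramified/additive p; p-converse consequences stated for p odd. No p = 2 version in print.) -/
theorem stub_heegnerNonTorsion_of_selmerCorankTwo_eq_one_additive :
    ∀ (W : WeierstrassCurve ℚ) [W.IsElliptic] [W.IsGloballyMinimal] [NeZero (W.conductorNorm ℤ)], ¬ W.HasCM →
      Rank1Residual.Addv W 2 →
      ∀ (K : Type) [Field K] [NumberField K], IsImaginaryQuadratic K →
        SatisfiesHeegnerHypothesis (W.conductorNorm ℤ) K → SatisfiesHeegnerHypothesis 2 K →
        (W.baseChange K).selmerCorank 2 = 1 →
        ∀ (P : (W.baseChange K).toAffine.Point), IsHeegnerPoint (W.conductorNorm ℤ) W K P → ¬ IsOfFinAddOrder P := by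
  sorry

/-- The class split (reduction trichotomy, pure logic): off (good ordinary ∨ multiplicative) at 2 means good supersingular or
additive at 2 (`Rank1Residual.GoodOrd/GoodSS/Mult/Addv`). [folklore] -/
theorem goodSS_or_addv_of_not_goodOrd_or_mult (W : WeierstrassCurve ℚ) [W.IsGloballyMinimal]
    (h : ¬ (Rank1Residual.GoodOrd W 2 ∨ Rank1Residual.Mult W 2)) :
    Rank1Residual.GoodSS W 2 ∨ Rank1Residual.Addv W 2 := by
  by_cases hg : W.HasGoodReductionAtPrime 2
  · left
    refine ⟨hg, ?_⟩
    by_contra hdiv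
    exact h (Or.inl ⟨hg, hdiv⟩)
  · right
    exact ⟨hg, fun hm => h (Or.inr hm)⟩

/-- **Composition (kernel-checked): `RankOneTwoConverseOffSemistableAtTwo`** = the route decl
`Theses.GenusKolyvaginAtTwo.RankOneTwoConverseOffSemistableAtTwo` (item 24948) BY NAME, from the four stubs along the printed corank-1 converse road (BSTW arXiv:2409.01350, proof of Thm 12.3, p. 96;
tree template `analyticRank_eq_one_of_selmerCorank_eq_one_of_rootNumber_eq_neg_one`) at p = 2: sign −1 (stub SIGN) ⇒ Heegner field K
with 2 split and L(E^K,1) ≠ 0 (FH) ⇒ Sel_{2^∞}(E^K/ℚ) finite (Kato ⇐ GZK) ⇒ corank over K is 1 (PROVED base-change identity) ⇒ P_K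
non-torsion (research stubs (a′)/(b′), after the PROVED class split) ⇒ ord L(E/K,s) = 1 (Gross–Zagier ⇐ items 24148, 19382) ⇒ ord L(E,s) = 1 (factorisation).
[cite: BurungaleSkinnerTianWan2024, Thm. 12.3 (proof, p. 96)] [cite: GrossZagier1986, Thm. I.6.3] -/
theorem RankOneTwoConverseOffSemistableAtTwo_of : RankOneTwoConverseOffSemistableAtTwo := by
  intro W _ _ hcm hred hsel
  obtain ⟨hmod, hGZall, hGZK, hFH, hHeeg⟩ := stub_printedLeaves
  have hE : WeierstrassCurve.hasEntireLFunction_rat := hasEntireLFunction_rat_of_exists_isNewformOf hmod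
  -- (1) the sign is `-1`
  have hw : W.rootNumber = -1 := by
    have hpar : p_parity W 2 := stub_twoParityDD W
    unfold p_parity at hpar
    rw [hsel, pow_one] at hpar
    exact hpar.symm
  -- (2) the Heegner field with `2` split and a rank-`0` twist
  obtain ⟨K, _, _, hK, -, hHN, hH2, hL1⟩ := hFH W hw 2 Nat.prime_two 0
  have hd : (NumberField.discr K : ℚ) ≠ 0 := by exact_mod_cast NumberField.discr_ne_zero K
  haveI := W.isElliptic_quadraticTwist hd
  obtain ⟨-, -, hfin⟩ :=
    kato_finite_of_L_one_ne_zero_of_rank_eq_analyticRank (W.quadraticTwist (NumberField.discr K : ℚ)) 2 hGZK hL1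
  haveI := hfin
  have h0 : (W.quadraticTwist (NumberField.discr K : ℚ)).selmerCorank 2 = 0 :=
    (W.quadraticTwist (NumberField.discr K : ℚ)).selmerCorank_eq_zero_of_finite 2
  have hK1 : (W.baseChange K).selmerCorank 2 = 1 := by
    rw [selmerCorank_baseChange_quadratic_holds W K hK.1 2, hsel, h0]
  -- (3) the Heegner point is non-torsion (research stubs, by reduction type at 2)
  haveI : NeZero (W.conductorNorm ℤ) := ⟨(WeierstrassCurve.conductorNorm_pos_holds W).ne'⟩
  obtain ⟨P, hP⟩ := hHeeg W K hK hHN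
  have hnt : ¬ IsOfFinAddOrder P := by
    rcases goodSS_or_addv_of_not_goodOrd_or_mult W hred with hss | hadd
    · exact stub_heegnerNonTorsion_of_selmerCorankTwo_eq_one_goodSS W hcm hss K hK hHN hH2 hK1 P hP
    · exact stub_heegnerNonTorsion_of_selmerCorankTwo_eq_one_additive W hcm hadd K hK hHN hH2 hK1 P hP
  -- (4) Gross–Zagier over `K`, then the factorisation `L(E/K,s) = L(E,s) L(E^K,s)`
  have hEK : analyticRankEK W K = 1 :=
    (analyticRankEK_eq_one_iff_heegner_nonTorsion_of_exists_isNewformOf W (W.conductorNorm ℤ) K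
      (hGZall (W.conductorNorm ℤ) W K) hmod hK rfl hHN hP).2 hnt
  rw [analyticRankEK_eq_add_of hE W K,
    Literature.NumberTheory.EllipticCurves.analyticRank_eq_zero_of_entireLFunction_one_ne_zero _ hL1, add_zero] at hEK
  exact hEK

end Summit.BirchSwinnertonDyer.BirchSwinnertonDyer.Cruxes.RankOneTwoConverseOffSemistableAtTwo.HeegnerFieldRoadOffSemistable
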